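import Summits.QuantumFields.YangMills.Theorems.SwapVirialDeficitZeroModeGroupThreeHub
import HarnessLib

/-!
# Exact zero-mode rung on the GROUP, three letters — V-c: THE LIMIT `β²·Λ₃(β) → v₃ > 0`
# (rung Z4 in Laplace form; LEAD ym-line-sfw-p2 g93's «exact zero-mode asymptotics»; free-hands support of ⟨stmt-QuantumFields-24197⟩)

★★★ `tendsto_sq_mul_laplaceThree : ∃ v > 0, β²·Λ₃(β) → v` as `β → ∞`, where (part I)
`Λ₃(β) = ∫_{SU(2)³} exp(−β(‖[q₀,q₁]‖² + ‖[q₀,q₂]‖² + ‖[q₁,q₂]‖²)) dHaar³` is the exact three-letter commutator (zero-mode) block on the GROUP: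
exponent `2 = (dim of the two transverse planes)/2`, NO logarithm, `v₃ = coneConst³·∫∫∫ h_0 > 0` — the Laplace-side twin of the `k = 3` line
`m₃(t) = v t⁴(1+o(1))` of the «sharp-sigma» zero-mode table (w3 g62's ✓`zeroModeZ_three_sharp` is the Gaussian-model version).
Assembly of parts I–V-b by two dominated-convergence steps:
* §1 INNER step (★★ `tendsto_lintegral_hsc`): for a hub with `0 < ‖a‖ ≤ 1`, `r = ‖Im a‖ > 0`, `∫∫ h_{β⁻¹} → ∫∫ h_0` on `ℍ × ℍ`
  (measurability of `h_s`, domination ✓`hsc_le_dominator`, `∫∫ G_r < ∞` ✓`lintegral_dominator_le`, pointwise limit ✓`tendsto_hsc` off the null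
  set `{x₀ = 0}`);
* §2 OUTER step over the hub `a ∼ cone` (bound `c²·4(π²/48)(‖Im a‖²)^{−4/3}I(1/3)²`, hub straightening ✓`psiCone_eq_axis` a.e., scaling
  ✓`sq_mul_psiCone_eq_lintegral_hsc`), identification `∫ F_β dcone = ofReal(β²Λ₃(β))` (✓`ofReal_laplaceThree_eq_lintegral_psiCone`), finiteness and
  positivity of the limit (`∫∫ h_0 > 0`: the integrand is positive on `B⁴ × B⁴`).
HONEST LABEL: finite-dimensional real analysis on `SU(2)³` (plan-level zero-mode rung, Laplace/Abelian side — by the Tauberian caution of fcl-p3 g44 it does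
NOT by itself give the small-ball form with a power rate); NOT the fixed-`L` sharp law, NOT ⟨24197⟩; the Yang–Mills mass gap is NOT proved; no summit is
proved by a line.  Width seat ym-line-sfw-p2-w2 g55 (cell ym-idea-1, free hands; own crux ⟨22884⟩ blocked-on ⟨19935⟩), `--supports stmt-QuantumFields-24197`.
Standard axioms, 0 `sorry`; the three local instances of the ToronLog files.
References: [cite: GonzalezarroyoAltes1988]; [cite: Vanbaal2001]; [folklore].
-/

set_option autoImplicit false

noncomputable section

open MeasureTheory Quaternion Set Filter Topology
open scoped Quaternion ENNReal
open Literature.MathematicalPhysics.QuantumLattice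
open Summit.QuantumFields.YangMills.Theorems.SwapTwistDeficit.ToronLog

attribute [local instance] Literature.Analysis.FluidPDE.Tao2016.quatMeasurableSpace
  Literature.Analysis.FluidPDE.Tao2016.quatBorelSpace
  Literature.MathematicalPhysics.QuantumLattice.secondCountableTopology_su2

namespace Summit.QuantumFields.YangMills.Theorems.SwapVirialDeficit.ZeroModeGroup

/-! ## §1 The inner dominated-convergence step on `ℍ × ℍ` -/

/-- Off a `vol ⊗ vol`-null set both letters have `N_0 ≠ 0` (the hypothesis of ✓`tendsto_hsc`). [folklore] -/
theorem ae_nsc_zero_ne : ∀ᵐ z ∂((volume : Measure ℍ).prod volume), nsc 0 z.1 ≠ 0 ∧ nsc 0 z.2 ≠ 0 := by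
  have h1 : ∀ᵐ x ∂(volume : Measure ℍ), nsc 0 x ≠ 0 := by
    have h : ∀ᵐ a ∂(volume : Measure ℍ), a.re ≠ 0 := by
      rw [ae_iff]; simpa only [ne_eq, not_not] using volume_re_eq_zero
    filter_upwards [h] with x hx
    rw [nsc_zero]
    intro h0
    have : x.re ^ 2 = 0 := by nlinarith [sq_nonneg x.re, sq_nonneg x.imI]
    exact hx ((pow_eq_zero_iff two_ne_zero).1 this)
  filter_upwards [(Measure.quasiMeasurePreserving_fst (μ := (volume : Measure ℍ)) (ν := (volume : Measure ℍ))).ae h1,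
    (Measure.quasiMeasurePreserving_snd (μ := (volume : Measure ℍ)) (ν := (volume : Measure ℍ))).ae h1] with z hz1 hz2
  exact ⟨hz1, hz2⟩

/-- ★★ **INNER LIMIT**: for hub parameters `0 < A ≤ 1`, `r > 0`, `∫∫ h_{β⁻¹} → ∫∫ h_0` as `β → ∞` (dominated convergence on `ℍ × ℍ`
with the β-free dominator `G_r`). [folklore] -/
theorem tendsto_lintegral_hsc {A r : ℝ} (hA0 : 0 < A) (hA1 : A ≤ 1) (hr : 0 < r) :
    Tendsto (fun β : ℝ => ∫⁻ z, hsc β⁻¹ A r z.1 z.2 ∂((volume : Measure ℍ).prod volume)) atTop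
      (𝓝 (∫⁻ z, hsc 0 A r z.1 z.2 ∂((volume : Measure ℍ).prod volume))) := by
  have hI := Ising_lt_top (c := 1/3) (by norm_num) (by norm_num)
  refine tendsto_lintegral_filter_of_dominated_convergence (fun z => dominator r z.1 z.2)
    (Eventually.of_forall fun β => measurable_hsc_uncurry _ _ _) ?_ ?_ ?_
  · filter_upwards [eventually_gt_atTop (0:ℝ)] with β hβ
    exact ae_of_all _ fun z => hsc_le_dominator (inv_pos.2 hβ) hA0.le hA1 (fun h => absurd h hA0.ne') z.1 z.2
  · exact (lt_of_le_of_lt (lintegral_dominator_le hr)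
      (ENNReal.mul_lt_top (by simp) (ENNReal.mul_lt_top ENNReal.ofReal_lt_top (ENNReal.mul_lt_top hI hI)))).ne
  · filter_upwards [ae_nsc_zero_ne] with z hz
    exact (tendsto_hsc z.1 z.2 hz.1 hz.2).comp tendsto_inv_atTop_nhdsGT_zero

/-- The limit integrand has a positive integral: `∫∫ h_0 > 0` (it is positive on `B⁴ × B⁴`). [folklore] -/
theorem lintegral_hsc_zero_pos (A r : ℝ) : 0 < ∫⁻ z, hsc 0 A r z.1 z.2 ∂((volume : Measure ℍ).prod volume) := by
  set T : Set ℍ := {x : ℍ | x.re ^ 2 + x.imI ^ 2 < 1} with hT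
  have hpos : ∀ z : ℍ × ℍ, z ∈ T ×ˢ T → hsc 0 A r z.1 z.2 ≠ 0 := by
    intro z hz
    have hz1 : z.1 ∈ {x : ℍ | nsc 0 x < 1} := by
      show nsc 0 z.1 < 1; rw [nsc_zero]; exact hz.1
    have hz2 : z.2 ∈ {x : ℍ | nsc 0 x < 1} := by
      show nsc 0 z.2 < 1; rw [nsc_zero]; exact hz.2
    rw [hsc_def, indicator_of_mem hz1, indicator_of_mem hz2, one_mul, one_mul]
    exact (ENNReal.ofReal_pos.2 (Real.exp_pos _)).ne'
  have hvolT : (volume : Measure ℍ) T ≠ 0 := by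
    have hsub : Metric.ball (0:ℍ) 1 ⊆ T := by
      intro x hx
      rw [Metric.mem_ball, dist_zero_right] at hx
      have h2 : ‖x‖ ^ 2 < 1 := by nlinarith [norm_nonneg x]
      show x.re ^ 2 + x.imI ^ 2 < 1
      rw [sq_norm_eq_sum_sq] at h2
      nlinarith [sq_nonneg x.imJ, sq_nonneg x.imK]
    exact fun h => (Metric.measure_ball_pos (volume : Measure ℍ) (0:ℍ) one_pos).ne' (measure_mono_null hsub h)
  refine pos_iff_ne_zero.2 fun h0 => ?_
  have hae := (lintegral_eq_zero_iff (measurable_hsc_uncurry 0 A r)).1 h0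
  have hnull : ((volume : Measure ℍ).prod volume) (T ×ˢ T) = 0 :=
    measure_mono_null (fun z hz => show ¬ (hsc 0 A r z.1 z.2 = 0) from hpos z hz) (ae_iff.1 hae)
  rw [Measure.prod_prod] at hnull
  exact (mul_ne_zero hvolT hvolT) hnull

/-! ## §2 The outer dominated-convergence step over the hub and the main theorem -/

/-- `Λ₃(β) ≥ 0`. [folklore] -/
theorem laplaceThree_nonneg (β : ℝ) : 0 ≤ laplaceThree β := by
  unfold laplaceThree
  exact integral_nonneg fun _ => (Real.exp_pos _).le

/-- ★★★ **THE EXACT THREE-LETTER ZERO-MODE RUNG ON THE GROUP (Laplace form)**: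
`∃ v > 0, β²·∫_{SU(2)³} e^{−β(‖[q₀,q₁]‖² + ‖[q₀,q₂]‖² + ‖[q₁,q₂]‖²)} dHaar³ → v` as `β → ∞` — exponent `2`, NO logarithm, `v` an explicit positive
`coneConst³`-weighted Gaussian-type integral.  HONEST LABEL: plan-level zero-mode rung (Abelian side); NOT the fixed-`L` sharp law; the Yang–Mills mass gap
is NOT proved. [folklore] -/
theorem tendsto_sq_mul_laplaceThree :
    ∃ v : ℝ, 0 < v ∧ Tendsto (fun β : ℝ => β ^ 2 * laplaceThree β) atTop (𝓝 v) := by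
  haveI := isProbabilityMeasure_coneMeasure
  set c : ℝ≥0∞ := ENNReal.ofReal coneConst with hc
  have hcne : c ≠ 0 := (ENNReal.ofReal_pos.2 coneConst_pos).ne'
  set K : ℝ → ℍ → ℝ≥0∞ := fun s a =>
    ∫⁻ z, hsc s (‖axisPoint a‖ ^ 2) (axisPoint a).imI z.1 z.2 ∂((volume : Measure ℍ).prod volume) with hK
  set F : ℝ → ℍ → ℝ≥0∞ := fun β a => ENNReal.ofReal (β ^ 2) * psiCone β a with hF
  set f : ℍ → ℝ≥0∞ := fun a => c * (c * K 0 a) with hf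
  set bound : ℍ → ℝ≥0∞ := fun a =>
    c * (c * (4 * (ENNReal.ofReal (Real.pi ^ 2 / 48 * (‖a.im‖ ^ 2) ^ (-(4/3 : ℝ))) * (Ising (1/3) * Ising (1/3))))) with hbound
  -- a.e. properties of the hub
  have hae : ∀ᵐ a ∂coneMeasure, a ∈ Metric.ball (0:ℍ) 1 ∧ a.imJ ≠ 0 ∧ coneQ a ≠ 0 := by
    have h1 : ∀ᵐ a ∂coneMeasure, a ∈ Metric.ball (0:ℍ) 1 := by
      unfold coneMeasure; exact Measure.ae_smul_measure (ae_restrict_mem measurableSet_ball) _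
    filter_upwards [h1, ae_cone_imJ_ne_zero, ae_coneQ_ne_zero] with a ha hb hq using ⟨ha, hb, hq⟩
  -- the rescaled representation of `F β a` at a good hub
  have hFK : ∀ a : ℍ, coneQ a ≠ 0 → ∀ β : ℝ, 0 < β → F β a = c * (c * K β⁻¹ a) := by
    intro a ha β hβ
    simp only [hF, hK]
    rw [psiCone_eq_axis β ha, sq_mul_psiCone_eq_lintegral_hsc hβ (axisPoint a) (axisPoint_components a).2.2.1
      (axisPoint_components a).2.2.2, lintegral_lintegral_hsc_eq]
  -- the hub parameters at a good hub
  have hpar : ∀ a : ℍ, a ∈ Metric.ball (0:ℍ) 1 → a.imJ ≠ 0 →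
      0 < ‖axisPoint a‖ ^ 2 ∧ ‖axisPoint a‖ ^ 2 ≤ 1 ∧ 0 < (axisPoint a).imI ∧ (axisPoint a).imI ^ 2 = ‖a.im‖ ^ 2 := by
    intro a ha hJ
    have hane : a ≠ 0 := fun h => hJ (by rw [h]; rfl)
    rw [norm_axisPoint, (axisPoint_components a).2.1]
    have hlt : ‖a‖ < 1 := by rwa [Metric.mem_ball, dist_zero_right] at ha
    refine ⟨pow_pos (norm_pos_iff.2 hane) 2, by nlinarith [norm_nonneg a], norm_im_pos_of_imJ_ne_zero hJ, rfl⟩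
  -- DCT hypotheses
  have h_meas : ∀ᶠ β in atTop, Measurable (F β) := Eventually.of_forall fun β => (measurable_psiCone β).const_mul _
  have h_bound : ∀ᶠ β in atTop, ∀ᵐ a ∂coneMeasure, F β a ≤ bound a := by
    filter_upwards [eventually_gt_atTop (0:ℝ)] with β hβ
    filter_upwards [hae] with a ha
    obtain ⟨hA0, hA1, hr, hr2⟩ := hpar a ha.1 ha.2.1
    rw [hFK a ha.2.2 β hβ]
    simp only [hbound, hK]
    rw [← hr2]
    refine mul_le_mul' le_rfl (mul_le_mul' le_rfl ?_)
    calc ∫⁻ z, hsc β⁻¹ (‖axisPoint a‖ ^ 2) (axisPoint a).imI z.1 z.2 ∂((volume : Measure ℍ).prod volume)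
        ≤ ∫⁻ z, dominator (axisPoint a).imI z.1 z.2 ∂((volume : Measure ℍ).prod volume) :=
          lintegral_mono fun z => hsc_le_dominator (inv_pos.2 hβ) hA0.le hA1 (fun h => absurd h hA0.ne') z.1 z.2
      _ ≤ _ := lintegral_dominator_le hr
  have hmD : Measurable fun a : ℍ => 4 * (ENNReal.ofReal (Real.pi ^ 2 / 48 * (‖a.im‖ ^ 2) ^ (-(4/3 : ℝ))) * (Ising (1/3) * Ising (1/3))) :=
    ((ENNReal.measurable_ofReal.comp (measurable_const.mul
      (((Quaternion.continuous_im.norm).pow 2).measurable.pow_const _))).mul_const _).const_mul _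
  have h_fin : ∫⁻ a, bound a ∂coneMeasure ≠ ∞ := by
    simp only [hbound]
    rw [lintegral_const_mul _ (hmD.const_mul _), lintegral_const_mul _ hmD]
    exact ENNReal.mul_ne_top ENNReal.ofReal_ne_top (ENNReal.mul_ne_top ENNReal.ofReal_ne_top lintegral_cone_domBound_ne_top)
  have h_lim : ∀ᵐ a ∂coneMeasure, Tendsto (fun β => F β a) atTop (𝓝 (f a)) := by
    filter_upwards [hae] with a ha
    obtain ⟨hA0, hA1, hr, -⟩ := hpar a ha.1 ha.2.1
    have hT : Tendsto (fun β : ℝ => c * (c * K β⁻¹ a)) atTop (𝓝 (f a)) := by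
      simp only [hf, hK]
      exact ENNReal.Tendsto.const_mul (ENNReal.Tendsto.const_mul (tendsto_lintegral_hsc hA0 hA1 hr) (Or.inr ENNReal.ofReal_ne_top))
        (Or.inr ENNReal.ofReal_ne_top)
    refine hT.congr' ?_
    filter_upwards [eventually_gt_atTop (0:ℝ)] with β hβ
    exact (hFK a ha.2.2 β hβ).symm
  have hDCT := tendsto_lintegral_filter_of_dominated_convergence bound h_meas h_bound h_fin h_lim
  -- identification of the β-side
  have hint : ∀ β : ℝ, 0 < β → ∫⁻ a, F β a ∂coneMeasure = ENNReal.ofReal (β ^ 2 * laplaceThree β) := by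
    intro β hβ
    simp only [hF]
    rw [lintegral_const_mul _ (measurable_psiCone β), ← ofReal_laplaceThree_eq_lintegral_psiCone hβ.le,
      ← ENNReal.ofReal_mul (sq_nonneg β)]
  set L := ∫⁻ a, f a ∂coneMeasure with hL
  have hT2 : Tendsto (fun β : ℝ => ENNReal.ofReal (β ^ 2 * laplaceThree β)) atTop (𝓝 L) := by
    refine hDCT.congr' ?_
    filter_upwards [eventually_gt_atTop (0:ℝ)] with β hβ using hint β hβ
  -- the limit is finite …
  have hLtop : L ≠ ∞ := by
    refine ne_top_of_le_ne_top h_fin (le_of_tendsto hDCT ?_)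
    filter_upwards [h_bound] with β hβ using lintegral_mono_ae hβ
  -- … and positive
  have hfm : AEMeasurable f coneMeasure :=
    aemeasurable_of_tendsto_metrizable_ae atTop (fun β => ((measurable_psiCone β).const_mul _).aemeasurable) h_lim
  have hLpos : L ≠ 0 := by
    intro hL0
    have hae0 := (lintegral_eq_zero_iff' hfm).1 hL0
    have hfpos : ∀ a, f a ≠ 0 := fun a => by
      simp only [hf, hK]
      exact mul_ne_zero hcne (mul_ne_zero hcne (lintegral_hsc_zero_pos _ _).ne')
    have hfalse : ∀ᵐ a ∂coneMeasure, False := by filter_upwards [hae0] with a ha using hfpos a ha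
    rw [eventually_false_iff_eq_bot, ae_eq_bot] at hfalse
    exact (IsProbabilityMeasure.ne_zero coneMeasure) hfalse
  refine ⟨L.toReal, ENNReal.toReal_pos hLpos hLtop, ?_⟩
  have hT3 := (ENNReal.tendsto_toReal hLtop).comp hT2
  refine hT3.congr' (Eventually.of_forall fun β => ?_)
  simp only [Function.comp_apply]
  rw [ENNReal.toReal_ofReal (mul_nonneg (sq_nonneg β) (laplaceThree_nonneg β))]

end Summit.QuantumFields.YangMills.Theorems.SwapVirialDeficit.ZeroModeGroup

end
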